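import Mathlib
import Literature.NumberTheory.Automorphic.AutomorphicKernel
import Literature.NumberTheory.Automorphic.SelbergTransformDecayProofs

/-!
# Corollary 12.2 for `SL₂(ℤ)` from the modular pretrace estimate alone
(Iwaniec, *Spectral Methods of Automorphic Forms*, GSM 53, (12.5), Theorem 12.1, Corollary 12.2, PDF pp. 125–126)

Eighth layer of the `provefact` decomposition of `Literature.NumberTheory.Automorphic.sl2BallCount_asymp`
(`HyperbolicLatticeCount.lean`). With (12.9) discharged (`Iwaniec2002_eq_12_9_holds`,
`SelbergTransformDecayProofs.lean`) the reductions of `AutomorphicKernel.lean` lose that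
hypothesis:

1. `Iwaniec2002_thm_12_1_of_eq_12_5 : Iwaniec2002_eq_12_5 → Iwaniec2002_thm_12_1` and
   `sl2BallCount_asymp_of_eq_12_5 : Iwaniec2002_eq_12_5 → Iwaniec2002_modular_smallSpectrum →
   sl2BallCount_asymp` (proved, one line each).
2. NAMED FACT `Iwaniec2002_eq_12_5_modular`: the estimate (12.5) for the modular group, whose sum
   over `1/2 < s_j ≤ 1` is the single term `s₀ = 1`, `u₀ = |F|^{-1/2} = √(3/π)` (Corollary 11.5 and
   the note to Theorem 12.1): `K(z, w) = 2 · (3/π) · h(i/2) + O(H(0) + ∫_0^∞ (t + 1) H(t) dt)` in the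
   matrix normalisation of `automorphicKernel`. It is the instance `Γ = SL₂(ℤ)` of the pair of
   named facts `Iwaniec2002_eq_12_5`, `Iwaniec2002_modular_smallSpectrum`
   (`Iwaniec2002_eq_12_5_modular_of`, proved), and it is the natural target of a future
   formalisation of the spectral theory of `L²(SL₂(ℤ)\ℍ)` (one cusp, `E(z, s)` with constant term
   `y^s + φ(s) y^{1-s}`, `φ = ξ(2s - 1)/ξ(2s)`), which is far more explicit than the theory for a
   general finite volume group required by `Iwaniec2002_eq_12_5`.
3. PROVED from 2 alone: the kernel estimate `Σ_{γ ∈ SL₂(ℤ)} k_{X,Y}(u(γi, i)) = 6X + O(E(X, Y))`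
   (`modular_automorphicKernel_latticeKernel_estimate`; the main term is exact,
   `2 (3/π) h(i/2) = 6X - 12 + 3Y` by `selbergTransform_latticeKernel_I_half`), the uniform bound
   `|P(X) - 6X| ≤ C X^{2/3}` for `X ≥ 2` (`modular_hyperbolicLatticeCount_bound_of_modular`, the
   sandwich (12.7) with `Y = X^{2/3}`), (12.12) as printed, and
   **`sl2BallCount_asymp_of_modular : Iwaniec2002_eq_12_5_modular → sl2BallCount_asymp`**.

State of the decomposition after this layer: `sl2BallCount_asymp ⇐ Iwaniec2002_eq_12_5_modular`
(one named fact: the pretrace formula, Theorem 7.4, with the local Weyl law (7.10), for `SL₂(ℤ)`,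
and Corollary 11.5); and `Iwaniec2002_thm_12_1 ⇐ Iwaniec2002_eq_12_5` for general finite volume
groups. Proved so far (layers 0–8): (12.7), (12.10)–(12.11), the transform calculus (1.62) and
conditions (1.63) for `k_{X,Y}`, (12.8), (12.9), the optimisation `Y = X^{2/3}`, `|F| = π/3`,
discreteness of `SL₂(ℤ)` and the fundamental domain property of `𝒟`.

Held copy: `book:iwaniec2002-spectral-methods-automorphic-forms` (pp. 120–127 read).
-/

noncomputable section

namespace Literature.NumberTheory.Automorphic

open MeasureTheory Set Filter Real UpperHalfPlane Asymptotics
open scoped Topology MatrixGroups ComplexConjugate Modular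

/-! ## 1. Theorem 12.1 and `sl2BallCount_asymp` with (12.9) discharged -/

/-- **Theorem 12.1 from (12.5) alone**: `Iwaniec2002_thm_12_1_of` with the "reader's" estimate
(12.9) supplied by `Iwaniec2002_eq_12_9_holds`; both transform estimates (12.8), (12.9) and the
conditions (1.63) for `k_{X,Y}` being proved, the only remaining input of Chapter 12 is the
spectral estimate (12.5). [cite: Iwaniec2002, Thm 12.1, PDF p. 126] -/
theorem Iwaniec2002_thm_12_1_of_eq_12_5 (h125 : Iwaniec2002_eq_12_5) : Iwaniec2002_thm_12_1 :=
  Iwaniec2002_thm_12_1_of h125 Iwaniec2002_eq_12_9_holds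

/-- **`sl2BallCount_asymp` from (12.5) and Corollary 11.5.** [cite: Iwaniec2002, Cor. 12.2, (12.12), PDF p. 126] -/
theorem sl2BallCount_asymp_of_eq_12_5 (h125 : Iwaniec2002_eq_12_5)
    (hss : Iwaniec2002_modular_smallSpectrum) : sl2BallCount_asymp :=
  sl2BallCount_asymp_of' h125 Iwaniec2002_eq_12_9_holds hss

/-! ## 2. The pretrace estimate for the modular group (named fact) -/

/-- **Iwaniec (12.5) for the modular group.** For `Γ = SL₂(ℤ)` the sum `Σ_{1/2 < s_j ≤ 1}` in
(12.5)/(12.6) consists of the single term `s₀ = 1`, `u₀ = |F|^{-1/2}` (constant), `|F| = π/3`: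
there are no exceptional eigenvalues for congruence groups of level `≤ 7` (Corollary 11.5, from
Roelcke's bound `λ₁ ≥ 3π²/2`, Theorem 11.4), and the residual spectrum of `SL₂(ℤ)` in
`1/2 < s ≤ 1` is the simple pole of `E(z, s)` at `s = 1` with constant residue ((6.33); note to
Theorem 12.1, p. 126: "`u₀(z) = |F|^{-1/2}`, thus the leading term is `2π|F|⁻¹X`"). Hence
(12.5) reads, for `z, w ∈ ℍ`, every continuous test kernel `k` whose transform `h` satisfies
(1.63), and every decreasing majorant `H` of `|h|` on `[0, ∞)`:
`K(z, w) = h(i/2) |F|⁻¹ + O(∫_0^∞ (t + 1) H(t) dt)`, the implied constant depending on `z, w`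
only. Formal shape exactly as in `Iwaniec2002_eq_12_5` (of which this is the instance
`Γ = 𝒮ℒ`, `F = 𝒟`, `B = {(1, √(3/π))}`, see `Iwaniec2002_eq_12_5_modular_of`): the kernel
`automorphicKernel` sums over matrices (twice the book's `K`, hence `2 · (3/π) · h(i/2)`), and the
error is `O(H(0) + ∫_0^∞ (t + 1) H(t) dt)` (weaker than printed). This single statement is what
the spectral theory of `L²(SL₂(ℤ)\ℍ)` (Chapters 3–7 and 11 of the book) contributes to
Corollary 12.2. [cite: Iwaniec2002, (12.5) & Thm 12.1 note, PDF pp. 125–126; Cor. 11.5, PDF p. 122] -/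
def Iwaniec2002_eq_12_5_modular : Prop :=
  ∀ z w : ℍ, ∃ C : ℝ, ∀ (k : ℝ → ℝ), Continuous k → IsTestKernel k →
    IsAdmissibleTransform (selbergTransform k) →
    ∀ (H : ℝ → ℝ), AntitoneOn H (Ici 0) →
      (∀ t : ℝ, 0 ≤ t → ‖selbergTransform k t‖ ≤ H t) →
      IntegrableOn (fun t => (t + 1) * H t) (Ioi 0) →
      ‖(automorphicKernel (𝒮ℒ : Subgroup (GL (Fin 2) ℝ)) k z w : ℂ) -
          2 * ((3 / π : ℝ) : ℂ) * selbergTransform k (Complex.I / 2)‖ ≤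
        C * (H 0 + ∫ t in Ioi 0, (t + 1) * H t)

/-- `Iwaniec2002_eq_12_5_modular` is the instance `Γ = SL₂(ℤ)`, `B = {(1, u₀)}` of the general
(12.5) given Corollary 11.5 (`Iwaniec2002_modular_smallSpectrum`, through
`modularSmallEigenbasis`). [cite: Iwaniec2002, (12.5), PDF pp. 125–126] -/
theorem Iwaniec2002_eq_12_5_modular_of (h125 : Iwaniec2002_eq_12_5)
    (hss : Iwaniec2002_modular_smallSpectrum) : Iwaniec2002_eq_12_5_modular := by
  intro z w
  obtain ⟨C, hC⟩ := h125 𝒮ℒ 𝒟 modular_le_range_toGL neg_one_mem_modular isDiscreteSubgroup_modular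
    isHypFundamentalDomain_modular_fd volume_modular_fd_lt_top (modularSmallEigenbasis hss) z w
  refine ⟨C, fun k hkc hkT hka H hH hHm hHi => ?_⟩
  have h := hC k hkc hkT hka H hH hHm hHi
  have e : 2 * ∑ j, selbergTransform k (Complex.I * (((modularSmallEigenbasis hss).s j - 1 / 2 : ℝ) : ℂ)) *
      (modularSmallEigenbasis hss).u j z * conj ((modularSmallEigenbasis hss).u j w) =
      2 * ((3 / π : ℝ) : ℂ) * selbergTransform k (Complex.I / 2) := by
    change 2 * ∑ _j : Fin 1, selbergTransform k (Complex.I * (((1 : ℝ) - 1 / 2 : ℝ) : ℂ)) *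
      modularU0 * conj modularU0 = _
    rw [Fin.sum_univ_one, mul_assoc (selbergTransform k _), modularU0_mul_conj,
      show Complex.I * (((1 : ℝ) - 1 / 2 : ℝ) : ℂ) = Complex.I / 2 by push_cast; ring]
    ring
  rwa [e] at h

/-! ## 3. Corollary 12.2 from the modular pretrace estimate -/

section Modular

variable (h125 : Iwaniec2002_eq_12_5_modular)
include h125

/-- **The kernel estimate for the modular group at `z = w = i`**: for `X ≥ 2Y ≥ 2`,
`|Σ_{γ ∈ SL₂(ℤ)} k_{X,Y}(u(γ i, i)) - 6X| ≤ A (Y + X^{1/2} + X Y^{-1/2} + X^{1/2} log X)`, from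
`Iwaniec2002_eq_12_5_modular` with the majorant `H = 1440√2 · majorant129 X Y` of (12.9)
(`Iwaniec2002_eq_12_9_holds`; `H(0) + ∫(t+1)H ≪ X Y^{-1/2} + X^{1/2} log X`) and the exact mass
`h(i/2) = π(X - 2 + Y/2)` (`selbergTransform_latticeKernel_I_half`), so that the main term
`2 · (3/π) · h(i/2) = 6X - 12 + 3Y` is `6X + O(Y)`. [cite: Iwaniec2002, proof of Thm 12.1 & Cor. 12.2, PDF p. 126] -/
theorem modular_automorphicKernel_latticeKernel_estimate :
    ∃ A : ℝ, 0 ≤ A ∧ ∀ X Y : ℝ, 1 ≤ Y → 2 * Y ≤ X →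
      ‖(automorphicKernel (𝒮ℒ : Subgroup (GL (Fin 2) ℝ)) (latticeKernel X Y) I I : ℂ) -
          ((6 * X : ℝ) : ℂ)‖ ≤ A * thm121Err X Y := by
  obtain ⟨C₅, hC₅⟩ := h125 I I
  obtain ⟨C₉, hC₉⟩ := Iwaniec2002_eq_12_9_holds
  set C₅' := max C₅ 0 with hC₅'
  set C₉' := max C₉ 0 with hC₉'
  have hC₅'0 : 0 ≤ C₅' := le_max_right _ _
  have hC₉'0 : 0 ≤ C₉' := le_max_right _ _
  set c₀ : ℝ := 2 * (1 / 2 : ℝ) ^ (-(5 / 2 : ℝ)) with hc₀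
  set c₁ : ℝ := 4 * (1 / 2 : ℝ) ^ (-(3 / 2 : ℝ)) + 2 * (1 / 2 : ℝ) ^ (-(5 / 2 : ℝ)) + 4 with hc₁
  have hc₀0 : 0 ≤ c₀ := by rw [hc₀]; positivity
  have hc₁0 : 0 ≤ c₁ := by rw [hc₁]; positivity
  refine ⟨C₅' * C₉' * (c₀ + c₁ + 8) + 15, by positivity, fun X Y hY hXY => ?_⟩
  have hX2 : 2 ≤ X := by linarith
  have hX1 : 1 ≤ X := by linarith
  have hY0 : 0 < Y := by linarith
  set k := latticeKernel X Y with hk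
  have hkT : IsTestKernel k := isTestKernel_latticeKernel X hY0
  have hkc : Continuous k := continuous_latticeKernel X Y
  have hka : IsAdmissibleTransform (selbergTransform k) :=
    Iwaniec2002_latticeKernel_admissible_holds X Y hY hXY
  set H : ℝ → ℝ := fun t => C₉' * majorant129 X Y t with hH
  have hHanti : AntitoneOn H (Ici 0) := by
    intro a ha b hb hab
    exact mul_le_mul_of_nonneg_left (majorant129_antitoneOn hX1 hY0 ha hb hab) hC₉'0
  have hHmaj : ∀ t : ℝ, 0 ≤ t → ‖selbergTransform k t‖ ≤ H t := by
    intro t _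
    calc ‖selbergTransform k t‖ ≤ C₉ * majorant129 X Y t := hC₉ X Y hY hXY t
      _ ≤ C₉' * majorant129 X Y t :=
          mul_le_mul_of_nonneg_right (le_max_left _ _) (majorant129_nonneg hX1 hY0 t)
  have hIM := integral_majorant129_le hY hXY
  have hHint : IntegrableOn (fun t => (t + 1) * H t) (Ioi 0) := by
    have hI : IntegrableOn (fun t => C₉' * ((t + 1) * majorant129 X Y t)) (Ioi 0) :=
      hIM.1.const_mul C₉'
    refine IntegrableOn.congr_fun hI (fun t _ => ?_) measurableSet_Ioi
    simp only [hH]; ring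
  have h5 := hC₅ k hkc hkT hka H hHanti hHmaj hHint
  -- the size of `H 0 + ∫ (t+1) H`
  have hInt_eq : ∫ t in Ioi 0, (t + 1) * H t = C₉' * ∫ t in Ioi 0, (t + 1) * majorant129 X Y t := by
    rw [← integral_const_mul]
    congr 1 with t
    simp only [hH]; ring
  have hRHS : H 0 + ∫ t in Ioi 0, (t + 1) * H t ≤
      C₉' * ((c₀ + c₁) * (X ^ (1 / 2 : ℝ) * Real.log X) + 8 * (X * Y ^ (-(1 / 2 : ℝ)))) := by
    rw [hInt_eq]
    have h0 := majorant129_zero_le (Y := Y) hX2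
    have hI := hIM.2
    simp only [hH]
    rw [← hc₀] at h0
    rw [← hc₁] at hI
    nlinarith
  have hRHS0 : 0 ≤ H 0 + ∫ t in Ioi 0, (t + 1) * H t := by
    have h0 : 0 ≤ H 0 := mul_nonneg hC₉'0 (majorant129_nonneg hX1 hY0 0)
    have hI : 0 ≤ ∫ t in Ioi 0, (t + 1) * H t := by
      apply setIntegral_nonneg measurableSet_Ioi
      intro t ht
      have : (0 : ℝ) < t := ht
      exact mul_nonneg (by linarith) (mul_nonneg hC₉'0 (majorant129_nonneg hX1 hY0 t))
    linarith
  have hE0 : 0 ≤ thm121Err X Y := thm121Err_nonneg hX1 hY0.le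
  have hE1 : X ^ (1 / 2 : ℝ) * Real.log X ≤ thm121Err X Y := by
    unfold thm121Err
    have : 0 ≤ X ^ (1 / 2 : ℝ) := Real.rpow_nonneg (by linarith) _
    have : 0 ≤ X * Y ^ (-(1 / 2 : ℝ)) := mul_nonneg (by linarith) (Real.rpow_nonneg hY0.le _)
    linarith
  have hE2 : X * Y ^ (-(1 / 2 : ℝ)) ≤ thm121Err X Y := by
    unfold thm121Err
    have : 0 ≤ X ^ (1 / 2 : ℝ) := Real.rpow_nonneg (by linarith) _
    have : 0 ≤ X ^ (1 / 2 : ℝ) * Real.log X :=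
      mul_nonneg (Real.rpow_nonneg (by linarith) _) (Real.log_nonneg hX1)
    linarith
  have hE3 : Y ≤ thm121Err X Y := by
    unfold thm121Err
    have : 0 ≤ X ^ (1 / 2 : ℝ) := Real.rpow_nonneg (by linarith) _
    have : 0 ≤ X * Y ^ (-(1 / 2 : ℝ)) := mul_nonneg (by linarith) (Real.rpow_nonneg hY0.le _)
    have : 0 ≤ X ^ (1 / 2 : ℝ) * Real.log X :=
      mul_nonneg (Real.rpow_nonneg (by linarith) _) (Real.log_nonneg hX1)
    linarith
  -- (12.5): kernel minus the main term `2 (3/π) h(i/2)`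
  have hA : ‖(automorphicKernel (𝒮ℒ : Subgroup (GL (Fin 2) ℝ)) k I I : ℂ) -
      2 * ((3 / π : ℝ) : ℂ) * selbergTransform k (Complex.I / 2)‖ ≤
      C₅' * C₉' * (c₀ + c₁ + 8) * thm121Err X Y := by
    refine h5.trans ?_
    calc C₅ * (H 0 + ∫ t in Ioi 0, (t + 1) * H t)
        ≤ C₅' * (H 0 + ∫ t in Ioi 0, (t + 1) * H t) :=
          mul_le_mul_of_nonneg_right (le_max_left _ _) hRHS0
      _ ≤ C₅' * (C₉' * ((c₀ + c₁) * (X ^ (1 / 2 : ℝ) * Real.log X) + 8 * (X * Y ^ (-(1 / 2 : ℝ))))) :=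
          mul_le_mul_of_nonneg_left hRHS hC₅'0
      _ ≤ C₅' * (C₉' * ((c₀ + c₁) * thm121Err X Y + 8 * thm121Err X Y)) := by
          gcongr
      _ = C₅' * C₉' * (c₀ + c₁ + 8) * thm121Err X Y := by ring
  -- the main term: `2 (3/π) h(i/2) = 6X - 12 + 3Y`
  have hB : ‖2 * ((3 / π : ℝ) : ℂ) * selbergTransform k (Complex.I / 2) - ((6 * X : ℝ) : ℂ)‖ ≤
      15 * thm121Err X Y := by
    rw [hk, selbergTransform_latticeKernel_I_half hX2 hY0]
    have e : 2 * ((3 / π : ℝ) : ℂ) * ((π * (X - 2 + Y / 2) : ℝ) : ℂ) - ((6 * X : ℝ) : ℂ) =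
        ((3 * Y - 12 : ℝ) : ℂ) := by
      push_cast
      field_simp
      ring
    rw [e, Complex.norm_real, Real.norm_eq_abs]
    have : |3 * Y - 12| ≤ 3 * Y + 12 := by
      refine abs_le.mpr ⟨by linarith, by linarith⟩
    linarith
  calc ‖(automorphicKernel (𝒮ℒ : Subgroup (GL (Fin 2) ℝ)) k I I : ℂ) - ((6 * X : ℝ) : ℂ)‖
      = ‖((automorphicKernel (𝒮ℒ : Subgroup (GL (Fin 2) ℝ)) k I I : ℂ) -
          2 * ((3 / π : ℝ) : ℂ) * selbergTransform k (Complex.I / 2)) +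
          (2 * ((3 / π : ℝ) : ℂ) * selbergTransform k (Complex.I / 2) - ((6 * X : ℝ) : ℂ))‖ := by
        congr 1; ring
    _ ≤ _ := norm_add_le _ _
    _ ≤ C₅' * C₉' * (c₀ + c₁ + 8) * thm121Err X Y + 15 * thm121Err X Y := add_le_add hA hB
    _ = (C₅' * C₉' * (c₀ + c₁ + 8) + 15) * thm121Err X Y := by ring

/-- **Corollary 12.2, uniform form, from the modular pretrace estimate**: for `Γ = SL₂(ℤ)`,
`z = w = i` and `X ≥ 2`, `|P(X) - 6X| ≤ C X^{2/3}` — the sandwich (12.7)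
`Σ_γ k_{X-Y,Y} ≤ P(X) ≤ Σ_γ k_{X,Y}`, the kernel estimate at `X` and `X - Y`, and `Y = X^{2/3}`
(`X ≥ 27`; the range `2 ≤ X < 27` is trivial). [cite: Iwaniec2002, Cor. 12.2 & proof of Thm 12.1, PDF p. 126] -/
theorem modular_hyperbolicLatticeCount_bound_of_modular :
    ∃ C : ℝ, ∀ X : ℝ, 2 ≤ X →
      |(hyperbolicLatticeCount (𝒮ℒ : Subgroup (GL (Fin 2) ℝ)) I I X : ℝ) - 6 * X| ≤
        C * X ^ (2 / 3 : ℝ) := by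
  obtain ⟨A, hA0, hKE⟩ := modular_automorphicKernel_latticeKernel_estimate h125
  set Γ : Subgroup (GL (Fin 2) ℝ) := 𝒮ℒ with hΓdef
  have hΓ := modular_le_range_toGL
  have hd := isDiscreteSubgroup_modular
  set P27 : ℝ := (hyperbolicLatticeCount Γ I I 27 : ℝ) with hP27
  have hP27_0 : 0 ≤ P27 := by positivity
  refine ⟨max (2 * (9 * A + 6)) (P27 + 6 * 27), fun X hX => ?_⟩
  have hX1 : 1 ≤ X := by linarith
  have hX0 : 0 < X := by linarith
  have hX23 : 1 ≤ X ^ (2 / 3 : ℝ) := Real.one_le_rpow hX1 (by norm_num)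
  have hCmax0 : 0 ≤ max (2 * (9 * A + 6)) (P27 + 6 * 27) :=
    le_trans (by positivity) (le_max_right _ _)
  rw [← Real.norm_eq_abs, ← Complex.norm_real, Complex.ofReal_sub, Complex.ofReal_natCast]
  rcases le_or_gt 27 X with h27 | h27
  · -- `X ≥ 27`, `Y = X^{2/3}`
    obtain ⟨hY1, h3Y, hE⟩ := thm121Err_opt h27
    set Y := X ^ (2 / 3 : ℝ) with hY
    have hY0 : 0 < Y := by linarith
    have h2Y : 2 * Y ≤ X := by linarith
    have h2Y' : 2 * Y ≤ X - Y := by linarith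
    have hXY1 : 1 ≤ X - Y := by linarith
    have hup := hyperbolicLatticeCount_le_automorphicKernel hΓ hd hY0 I I X
    have hlow := automorphicKernel_sub_le_hyperbolicLatticeCount hΓ hd hY0 I I X
    have hKp := hKE X Y hY1 h2Y
    have hKm := hKE (X - Y) Y hY1 h2Y'
    have hEm : thm121Err (X - Y) Y ≤ thm121Err X Y := thm121Err_mono hXY1 (by linarith) hY0.le
    set e : ℝ := (9 * A + 6) * Y with he
    have hp : ‖(automorphicKernel Γ (latticeKernel X Y) I I : ℂ) - ((6 * X : ℝ) : ℂ)‖ ≤ e := by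
      refine hKp.trans ?_
      rw [he]
      nlinarith
    have hm : ‖(automorphicKernel Γ (latticeKernel (X - Y) Y) I I : ℂ) - ((6 * X : ℝ) : ℂ)‖ ≤ e := by
      have e6 : ((6 * X : ℝ) : ℂ) = ((6 * (X - Y) : ℝ) : ℂ) + ((6 * Y : ℝ) : ℂ) := by
        push_cast; ring
      calc ‖(automorphicKernel Γ (latticeKernel (X - Y) Y) I I : ℂ) - ((6 * X : ℝ) : ℂ)‖
          = ‖((automorphicKernel Γ (latticeKernel (X - Y) Y) I I : ℂ) - ((6 * (X - Y) : ℝ) : ℂ)) -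
              ((6 * Y : ℝ) : ℂ)‖ := by rw [e6]; congr 1; ring
        _ ≤ ‖(automorphicKernel Γ (latticeKernel (X - Y) Y) I I : ℂ) - ((6 * (X - Y) : ℝ) : ℂ)‖ +
              ‖((6 * Y : ℝ) : ℂ)‖ := norm_sub_le _ _
        _ ≤ A * thm121Err (X - Y) Y + 6 * Y := by
            apply add_le_add hKm
            rw [Complex.norm_real, Real.norm_of_nonneg (by linarith)]
        _ ≤ A * thm121Err X Y + 6 * Y := by gcongr
        _ ≤ e := by rw [he]; nlinarith
    have hsand := norm_sub_le_of_sandwich hlow hup hp hm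
    calc ‖((hyperbolicLatticeCount Γ I I X : ℕ) : ℂ) - ((6 * X : ℝ) : ℂ)‖ ≤ 2 * e := by
          simpa using hsand
      _ = 2 * (9 * A + 6) * X ^ (2 / 3 : ℝ) := by rw [he, hY]; ring
      _ ≤ max (2 * (9 * A + 6)) (P27 + 6 * 27) * X ^ (2 / 3 : ℝ) :=
          mul_le_mul_of_nonneg_right (le_max_left _ _) (by linarith)
  · -- `2 ≤ X < 27`: everything is bounded
    have hP : (hyperbolicLatticeCount Γ I I X : ℝ) ≤ P27 := by
      rw [hP27]
      exact_mod_cast hyperbolicLatticeCount_mono hΓ hd I I h27.le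
    calc ‖((hyperbolicLatticeCount Γ I I X : ℕ) : ℂ) - ((6 * X : ℝ) : ℂ)‖
        ≤ ‖((hyperbolicLatticeCount Γ I I X : ℕ) : ℂ)‖ + ‖((6 * X : ℝ) : ℂ)‖ := norm_sub_le _ _
      _ ≤ P27 + 6 * 27 := by
          apply add_le_add
          · rw [← Complex.ofReal_natCast, Complex.norm_real, Real.norm_of_nonneg (by positivity)]
            exact hP
          · rw [Complex.norm_real, Real.norm_of_nonneg (by linarith)]
            linarith
      _ ≤ max (2 * (9 * A + 6)) (P27 + 6 * 27) := le_max_right _ _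
      _ ≤ max (2 * (9 * A + 6)) (P27 + 6 * 27) * X ^ (2 / 3 : ℝ) :=
          le_mul_of_one_le_right hCmax0 hX23

/-- (12.12) as printed (real `X → ∞`), from the modular pretrace estimate alone.
[cite: Iwaniec2002, Cor. 12.2, (12.12), PDF p. 126] -/
theorem modularHyperbolicCount_asymp_of_modular : modularHyperbolicCount_asymp := by
  obtain ⟨C, hC⟩ := modular_hyperbolicLatticeCount_bound_of_modular h125
  refine IsBigO.of_bound C ?_
  filter_upwards [eventually_ge_atTop (2 : ℝ)] with X hX
  rw [Real.norm_eq_abs, Real.norm_of_nonneg (Real.rpow_nonneg (by linarith) _)]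
  exact hC X hX

/-- **`sl2BallCount_asymp` from the modular pretrace estimate alone**: the number of integer
points on `ad - bc = 1` with `a² + b² + c² + d² ≤ N` is `6N + O(N^{2/3})`, conditionally only on
`Iwaniec2002_eq_12_5_modular` — (12.5) for `SL₂(ℤ)` with its one-point small spectrum, i.e. the
pretrace formula (Theorem 7.4) with the local Weyl law (7.10) for the modular group and
Corollary 11.5. Everything else in Iwaniec's proof of Corollary 12.2 ((12.7)–(12.11), (1.62)–(1.63)
for `k_{X,Y}`, (12.8), (12.9), `Y = X^{2/3}`) is proved in this and the preceding layers.
[cite: Iwaniec2002, Cor. 12.2, (12.12), PDF p. 126] -/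
theorem sl2BallCount_asymp_of_modular : sl2BallCount_asymp :=
  sl2BallCount_asymp_iff_modularHyperbolicCount_asymp.mpr (modularHyperbolicCount_asymp_of_modular h125)

end Modular

end Literature.NumberTheory.Automorphic

end
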